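import Literature.IUT.HodgeTheaters.FrobenioidBridgeModels
import Literature.IUT.HodgeTheaters.BaseThetaDatumModel
import HarnessLib

/-!
# A combinatorial inhabitant of the stub `S5Local` ([IUTchI] §5, Example 5.4 – Corollary 5.6) — consistency witness

The §5 slice-R4 statements (`FrobenioidBridgeModels.lean`, `ThetaNFHodgeTheaters.lean`) are typed over the local
hypothesis structure `S5Local 𝔡` (Frobenioid-level ambient data quoting Def. 5.2, Ex. 5.1, Ex. 5.4 (iv), Def. 3.6).
L5 KIT RULE (L5-lead 2026-08-25): such a kit ships with a kernel inhabitant. This file exhibits one over the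
combinatorial model `BaseThetaDatum.trivialModel` of `BaseThetaDatumModel.lean` (`l = 5`, one bad place, one-object
ambient categories): the `ℱ`-level ambient categories are taken EQUAL to the base-level ones with identity base
functors, the arrows `⇢`, restriction data and valuations are trivial. Consequently the kit is CONSISTENT and — since
its base functor on `ℱ^⊚`-isomorphs is the identity — the rigidity hypothesis of the conditional discharges of
Cor. 5.6 (i)/(ii) in `ThetaNFHodgeTheatersProofs2.lean` (`S.baseGIso` bijective, i.e. Cor. 5.3 (i) in stub
vocabulary) is SATISFIABLE (`toyS5Local_baseGIso_bijective`), so those conditionals are not vacuous. NOT the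
arithmetic model (that is abc-iut-L5-t1's `FrobenioidBridgeModelsAdapter` row over the global Frobenioids of
Ex. 5.1); nothing here bears on the initial Θ-data of interest. Record-only [claim: Mochizuki2012, status: disputed];
nothing here takes a side.
-/

namespace Literature.IUT.HodgeTheaters

open CategoryTheory

namespace BaseThetaDatum

open TrivialModel

/-- **An inhabitant of `S5Local trivialModel`** (KIT RULE witness for the §5 R4 stub): `ℱ`-ambient categories :=
the base ambient categories of the trivial model, base functors := identities, `ℱ^⊛`-isomorphs := the global
one-object category, `⇢` / restriction data / `δ`-valuation assignments trivial, Θ-Hodge theaters := the global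
one-object groupoid with associated strip the model object. [claim: Mochizuki2012, status: disputed] -/
noncomputable def toyS5Local : S5Local trivialModel where
  FAmb _ := LocAmb
  F _ := SingleObj.star _
  nonempty_isoF _ _ _ := ⟨Iso.refl _⟩
  base _ := 𝟭 _
  FAmbG := GlobAmb
  FG := SingleObj.star _
  nonempty_isoFG _ _ := ⟨Iso.refl _⟩
  baseG Y := Y
  baseGIso b := b
  baseGIso_refl _ := rfl
  baseGIso_trans _ _ := rfl
  FAmbGlob := GlobAmb
  FGlob := SingleObj.star _
  nonempty_isoFGlob _ _ := ⟨Iso.refl _⟩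
  DashArrow _ _ := PUnit
  dashModel := PUnit.unit
  restrictAt _ _ _ := SingleObj.star _
  ThetaHT := GlobAmb
  HT := SingleObj.star _
  nonempty_isoHT _ _ := ⟨Iso.refl _⟩
  assocStrip _ _ := SingleObj.star _
  assocStripIso _ _ := Iso.refl _
  valOfNF _ := ()
  valOfNF_postNF _ _ := rfl
  valOfNF_preNF _ _ := rfl
  valOfNF_phiNF _ := rfl
  RestrictionDatum _ _ := PUnit
  restrictionOf _ _ _ := PUnit.unit

/-- **`S5Local` is consistent** over the trivial base model. [claim: Mochizuki2012, status: disputed] -/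
theorem nonempty_s5Local : Nonempty (S5Local trivialModel) := ⟨toyS5Local⟩

/-- In the witness the base functor on isomorphisms of `ℱ^⊚`-isomorphs is the identity, hence bijective: the
rigidity hypothesis "`S.baseGIso` bijective" (Cor. 5.3 (i) in stub vocabulary) of the conditional discharges of
Cor. 5.6 (i)/(ii) is satisfiable. [claim: Mochizuki2012, status: disputed] -/
theorem toyS5Local_baseGIso_bijective (Y Y' : toyS5Local.FAmbG) :
    Function.Bijective (toyS5Local.baseGIso : (Y ≅ Y') → (toyS5Local.baseG Y ≅ toyS5Local.baseG Y')) :=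
  Function.bijective_id

/-- Likewise the constituent base functors `ℱ_v ↦ 𝒟_v` of the witness are identities, so "`(S.base v).mapIso`
bijective" (Cor. 5.3 (ii) constituent-wise, the second input of `cor56i_of_rigid`) is satisfiable.
[claim: Mochizuki2012, status: disputed] -/
theorem toyS5Local_base_mapIso_bijective (v : trivialModel.V) (A B : toyS5Local.FAmb v) :
    Function.Bijective ((toyS5Local.base v).mapIso : (A ≅ B) → ((toyS5Local.base v).obj A ≅ (toyS5Local.base v).obj B)) := by
  refine ⟨fun e e' h => ?_, fun g => ⟨g, ?_⟩⟩
  · exact Iso.ext (congrArg Iso.hom h)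
  · exact Iso.ext rfl

end BaseThetaDatum

end Literature.IUT.HodgeTheaters
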